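import Literature.AlgebraicGeometry.Resolution.PrincipalizationToResolution
import Literature.AlgebraicGeometry.Resolution.AlterationsNodalBoundary
import Mathlib.AlgebraicGeometry.IdealSheaf.IrreducibleComponent
import Mathlib.AlgebraicGeometry.Noetherian
import HarnessLib

/-!
# Regular closed subschemes are locally irreducible; their ideal sheaves are the vanishing ideals of their supports

Topic `Literature/AlgebraicGeometry/Resolution`. Two pieces of bookkeeping about a quasi-coherent ideal sheaf
`C` on a locally Noetherian scheme `Y` whose closed subscheme `V(C)` is REGULAR (the centres of the blowing-ups in
H. Hironaka's local sequences of smooth blowing-ups, [Hironaka2005] Def 2.2 «D_i is a regular closed subscheme of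
U_i»), used to compare LSBs with arbitrary regular centres against LSBs with IRREDUCIBLE regular centres (the 2017
manuscript's Def. 2.4 «smooth (or only regular) irreducible»):

* `Scheme.IsRegular.exists_isOpen_isIrreducible_mem` — a locally Noetherian regular scheme is LOCALLY IRREDUCIBLE:
  every point has an irreducible open neighbourhood (Stacks 0357/033M: regular local rings are domains, so the
  irreducible components are pairwise disjoint and open — tree `Scheme.IsRegular.coe_irreducibleComponentOpen`);
* `exists_opens_isIrreducible_support_inter` — hence for `y ∈ V(C)` there is an open `V ∋ y` of the AMBIENT scheme
  with `V(C) ∩ V` irreducible;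
* `eq_vanishingIdeal_support_of_isReduced_subscheme` — an ideal sheaf with reduced closed subscheme IS the vanishing
  (reduced) ideal sheaf of its support (Mathlib `vanishingIdeal_support` + tree `radical_eq_of_isReduced_subscheme`);
  `comap_eq_vanishingIdeal_preimage_support` — the same after pulling back along an open immersion;
* `isRegular_subscheme_comap_of_isOpenImmersion` — `V(h^*C)` is regular for an open immersion `h` (public copy of the
  private lemma of `Hironaka2005InclLocality.lean`).

Everything PROVED; no definitions, no named facts.

## Sources
* The Stacks Project, Tag 0357 (normal ⇒ irreducible components disjoint) and Tag 033M. [StacksProject]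
* H. Hironaka, Sémin. Congr. 10 (2005), Def 2.2 p.93 (regular centres). [Hironaka2005]
-/

noncomputable section

open CategoryTheory TopologicalSpace
open _root_.AlgebraicGeometry

namespace Literature.AlgebraicGeometry.Resolution

open Scheme.IdealSheafData

universe u

/-! ## Regular schemes are locally irreducible -/

/-- **A locally Noetherian regular scheme is locally irreducible**: every point has an irreducible open
neighbourhood (the irreducible component through the point inside a Noetherian affine neighbourhood is open there,
`Scheme.IsRegular.coe_irreducibleComponentOpen`). [cite: StacksProject, Tag 0357] -/
theorem Scheme.IsRegular.exists_isOpen_isIrreducible_mem {S : Scheme.{u}} [IsLocallyNoetherian S]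
    (hS : Scheme.IsRegular S) (s : S) :
    ∃ W : Set S, IsOpen W ∧ IsIrreducible W ∧ s ∈ W := by
  obtain ⟨A, hA, hsA, -⟩ :=
    exists_isAffineOpen_mem_and_subset (X := S) (x := s) (U := ⊤) (Opens.mem_top s)
  haveI : CompactSpace A := isCompact_iff_compactSpace.mp hA.isCompact
  haveI : IsNoetherian (A : Scheme.{u}) := {}
  have hAreg : Scheme.IsRegular (A : Scheme.{u}) := hS.of_isOpenImmersion A.ι
  have hemb := A.ι.isOpenEmbedding
  -- the irreducible component of `⟨s, hsA⟩` in the Noetherian regular affine scheme `A` is open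
  have hC := irreducibleComponent_mem_irreducibleComponents (⟨s, hsA⟩ : A)
  have hopen : IsOpen (irreducibleComponent (⟨s, hsA⟩ : A)) := by
    rw [← hAreg.coe_irreducibleComponentOpen hC]
    exact ((A : Scheme.{u}).irreducibleComponentOpen _).isOpen
  refine ⟨A.ι '' irreducibleComponent (⟨s, hsA⟩ : A), hemb.isOpenMap _ hopen,
    isIrreducible_irreducibleComponent.image _ A.ι.continuous.continuousOn, ?_⟩
  exact ⟨⟨s, hsA⟩, mem_irreducibleComponent, rfl⟩

/-- **Regular closed subschemes are locally irreducible in the ambient scheme**: if the closed subscheme `V(C)` of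
the ideal sheaf `C` on a locally Noetherian `Y` is regular, every point `y` of its support has an open neighbourhood
`V ⊆ Y` such that `support C ∩ V` is irreducible. [cite: StacksProject, Tag 0357] -/
theorem exists_opens_isIrreducible_support_inter {Y : Scheme.{u}} [IsLocallyNoetherian Y]
    (C : Y.IdealSheafData) (hC : Scheme.IsRegular C.subscheme) {y : Y} (hy : y ∈ (C.support : Set Y)) :
    ∃ V : Y.Opens, y ∈ V ∧ IsIrreducible ((C.support : Set Y) ∩ V) := by
  haveI : IsLocallyNoetherian C.subscheme := LocallyOfFiniteType.isLocallyNoetherian C.subschemeι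
  -- `y` is the image of a point `s` of the closed subscheme
  have hy' : y ∈ Set.range C.subschemeι := by rwa [range_subschemeι]
  obtain ⟨s, rfl⟩ := hy'
  obtain ⟨W, hWo, hWirr, hsW⟩ := hC.exists_isOpen_isIrreducible_mem s
  -- `W = ι⁻¹ V` for an open `V` of `Y` (closed immersions are embeddings)
  have hind : Topology.IsInducing C.subschemeι := C.subschemeι.isClosedEmbedding.isInducing
  obtain ⟨V, hVo, hVW⟩ := hind.isOpen_iff.mp hWo
  refine ⟨⟨V, hVo⟩, ?_, ?_⟩
  · have : s ∈ C.subschemeι ⁻¹' V := by rw [hVW]; exact hsW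
    exact this
  · have himg : (C.support : Set Y) ∩ V = C.subschemeι '' W := by
      rw [← hVW, Set.image_preimage_eq_range_inter, range_subschemeι]
    change IsIrreducible ((C.support : Set Y) ∩ V)
    rw [himg]
    exact hWirr.image _ C.subschemeι.continuous.continuousOn

/-! ## Ideal sheaves with reduced subscheme are vanishing ideals -/

/-- An ideal sheaf whose closed subscheme is reduced is the vanishing (reduced) ideal sheaf of its support
(Mathlib `vanishingIdeal_support : vanishingIdeal I.support = I.radical`, and `I.radical = I`).
[cite: StacksProject, Tag 01J3] -/
theorem eq_vanishingIdeal_support_of_isReduced_subscheme {Y : Scheme.{u}} (I : Y.IdealSheafData)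
    [IsReduced I.subscheme] : vanishingIdeal I.support = I := by
  rw [vanishingIdeal_support, radical_eq_of_isReduced_subscheme]

/-- The closed subscheme of a pulled-back ideal sheaf along an open immersion is regular if the original closed
subscheme is (it is an open subscheme of it). [cite: StacksProject, Tag 02IS] -/
theorem isRegular_subscheme_comap_of_isOpenImmersion {X' X : Scheme.{u}} (h : X' ⟶ X)
    [IsOpenImmersion h] (C : X.IdealSheafData) (hC : Scheme.IsRegular C.subscheme) :
    Scheme.IsRegular (C.comap h).subscheme := by
  let j : (C.comap h).subscheme ⟶ C.subscheme := (C.comapIso h).hom ≫ Limits.pullback.snd h C.subschemeι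
  haveI : IsOpenImmersion j := inferInstance
  intro x
  haveI := hC (j x)
  exact IsRegularLocalRing.of_ringEquiv (asIso (j.stalkMap x)).commRingCatIsoToRingEquiv

/-- Along an open immersion `h`, the pull-back of an ideal sheaf `C` with regular closed subscheme is the vanishing
ideal of the preimage of its support: `h^*C = 𝓘(h⁻¹ V(C))`. [cite: StacksProject, Tag 01J3] -/
theorem comap_eq_vanishingIdeal_preimage_support {X' X : Scheme.{u}} (h : X' ⟶ X) [IsOpenImmersion h]
    (C : X.IdealSheafData) (hC : Scheme.IsRegular C.subscheme) :
    C.comap h = vanishingIdeal (C.support.preimage h.continuous) := by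
  haveI : IsReduced (C.comap h).subscheme := (isRegular_subscheme_comap_of_isOpenImmersion h C hC).isReduced
  rw [← support_comap, eq_vanishingIdeal_support_of_isReduced_subscheme]

/-- In particular `C = 𝓘(V(C))` as a `Closeds`-indexed vanishing ideal: for the closed subset `C.support`.
[cite: StacksProject, Tag 01J3] -/
theorem eq_vanishingIdeal_support_of_isRegular {Y : Scheme.{u}} (C : Y.IdealSheafData)
    (hC : Scheme.IsRegular C.subscheme) : C = vanishingIdeal C.support := by
  haveI : IsReduced C.subscheme := hC.isReduced
  exact (eq_vanishingIdeal_support_of_isReduced_subscheme C).symm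

end Literature.AlgebraicGeometry.Resolution

end
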